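import Summits.BirchSwinnertonDyer.BirchSwinnertonDyer.Theorems.ResidualThetaTransportAtTwoResidualThetaMainConjectureAtTwoMazurTateElementKThreeTerm
import Literature.NumberTheory.EllipticCurves.PAdicLFunctionInterpolationProofs
import Literature.NumberTheory.EllipticCurves.RohrlichNonvanishingProofs
import Mathlib.RingTheory.Polynomial.Cyclotomic.Roots
import HarnessLib

/-!
# Route `SignedLowerHalves`, crux L `SmallImageLowerHalfBothSigns` (stmt-BirchSwinnertonDyer-23599), line `rtt_w3` v36 — row S4″ (`stub_junctionRecipMT_ns`),
# brick β5 «recip-an VALUES»: THE VALUES OF THE MAZUR–TATE ELEMENTS `θ_n(g; Ω) ∈ K_g[T]` AT THE POINTS `ζ − 1`, `ζ ∈ μ_{pⁿ}`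

INPUTS hand `bsd-inputs-honda-p1` g30 under LEAD `cruxlead-stmt-BirchSwinnertonDyer-23599` (cell `bsd-ssimc`; RULING «O2 = A», 2026-08-31); helper
`--supports stmt-BirchSwinnertonDyer-23599`. THEOREMS ONLY (no definition, no named fact, no instance, no `sorry`).

WHY. With -w3's interpolating signed Coleman map (β4: `ω_n^{−ε}·Col x ≡ P_n(x) (mod ω_n)`, `P_n(x) = Σ_{i<pⁿ} C(ev_{n,i} x)(1+X)^{pⁿ−i}`) the registered
S4″ congruence `C d·θ_n(g;Ω)^ι ≡ (−1)^{n/2+1}·ω_n^{−ε}·C c·Col(jv(s ζ̄_𝔞)) (mod ω_n)` is the family of VALUE identities `d·θ_n(g;Ω)^ι(ζ − 1) = ±c·P_n(x)(ζ − 1)`,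
`ζ ∈ μ_{pⁿ}` (β7, LEAD). This file supplies the `θ`-side values, for ANY newform `g ∈ S₂(Γ₀(M))`, ANY Shimura period `Ω` (`IsPlusPeriod g Ω`), `p ∤ M`, `a_p(g) = 0`, read
through ANY ring homomorphism `φ : K_g → R` (`φ = ι : K_g → ℚ̄_p`, or `φ = e ∘ ι : K_g → ℂ` in the LEAD's frame):

* §1 IMPRIMITIVE REDUCTION (from the tree's three-term relation `ResidualThetaLayer.cyclotomicOmega_dvd_mazurTateElementK_add`, MTT §I.10 (10.2) with `a_p = 0`):
  `θ_{n+2}(ζ−1) = −Φ_{p^{n+1}}(ζ)·θ_n(ζ−1)` for `ζ^{p^{n+1}} = 1` (`eval₂_mazurTateElementK_add_two`); hence ★ `θ_{m+2k}(ζ−1) = (−p)^k·θ_m(ζ−1)` when `ζ^{p^m} = 1`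
  (`eval₂_mazurTateElementK_add_two_mul`) and ★ `θ_{m+2+2k}(ζ−1) = 0` when moreover `Φ_{p^{m+1}}(ζ) = 0`, e.g. `ζ` of exact order `p^{m+1}`
  (`eval₂_mazurTateElementK_eq_zero_of_isPrimitiveRoot`): a character of `G_n` of conductor `p^{m+e₀}` sees a non-zero value only at the levels `n ≡ m (mod 2)`, and there the value
  is `(−p)^{(n−m)/2}` times the PRIMITIVE value at level `m`.
* §2 CHARACTER VALUES over ANY commutative ring `R` (the tree's `ResidualThetaLayer.eval₂_map_mazurTateElementK_eq_sum` is the case `R = ℂ_p`): for every EVEN `p`-POWER-ORDER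
  `R`-valued Dirichlet character `χ` mod `p^{n+e₀}`, `θ_n(g;Ω)^φ(χ(γ) − 1) = Σ_{a mod p^{n+e₀}} χ(a)·φ[a/p^{n+e₀}]⁺_{g,Ω}` (`eval₂_mazurTateElementK_eq_sum`); the trivial character:
  `θ_n(g;Ω)^φ(0) = Σ_{a ∈ (ℤ/p^{n+e₀})ˣ} φ[a/p^{n+e₀}]⁺_{g,Ω}` (`eval₂_mazurTateElementK_zero`).
* §3 THE BOTTOM (`p` odd, trivial character): `Σ_{(ℤ/p)ˣ}[a/p]⁺_{g,Ω} = −2·[0]⁺_{g,Ω}`, `Σ_{(ℤ/p²)ˣ}[a/p²]⁺_{g,Ω} = −(p−1)·[0]⁺_{g,Ω}` (Hecke-nullity `Σ_{j<p}[(r+j)/p]⁺ = −[pr]⁺` at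
  `a_p = 0`, `ℤ`-periodicity), hence ★ `θ_{2k}(g;Ω)^φ(0) = (−p)^k·φ(−2[0]⁺)`, `θ_{2k+1}(g;Ω)^φ(0) = (−p)^k·φ(−(p−1)[0]⁺)`, where `[0]⁺_{g,Ω}·Ω = {∞,0}_g = L(g,1)`.
* §4 ★★★ PRIMITIVE VALUES IN CLOSED FORM (`R = ℂ`; Birch's formula is a tree THEOREM, `twisted_LValue_eq_holds`, for every `CuspForm (Gamma0 N) 2`): if a cusp form `g'` and a number
  `Ω' ∈ ℂ` TRANSPORT the symbols of `(g, Ω)` along `φ : K_g → ℂ` — `plusSymbol g' r = Ω'·φ([r]⁺_{g,Ω})` for all `r ∈ ℚ` (for `φ = e∘ι` and `g' = θ_ψ` this is Shimura's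
  σ-equivariance of the periods of conjugate newforms, [Shimura1977] Thm. 1, to be typed separately as ONE print fact) — then for every PRIMITIVE even `p`-power-order `χ`
  mod `p^{n+e₀}` and every entire continuation `L` of `L(g', χ̄, s)`: `Ω'·θ_n(g;Ω)^φ(χ(γ) − 1) = τ(χ)·L(g', χ̄, 1)` (`mul_eval₂_mazurTateElementK_eq_gaussSum_mul`), and at the bottom
  `Ω'·φ[0]⁺_{g,Ω} = L(g', 1)` (`mul_map_plusSymbolK_zero_eq`).

HONEST FRAMING: these are the ANALYTIC-side values only; the `P`-side (β2 ∘ β3: Wiles' explicit reciprocity and the Coates–Wiles derivatives of the elliptic units) and the assembly β7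
are NOT here; S4″, crux L, crux M and BSD remain OPEN and are proved for NO curve by any of this.
References: [MazurTateTeitelbaum1986Invent] §I.4 (4.2), §I.8 (8.6), §I.10 (10.2), §I.13; [Pollack2003] §6.5, Prop. 6.18 (proof); [PollackWeston2011MT] §2.1–2.2, Prop. 2.3;
[Birch1971]; [Shimura1977] Thm. 1.
-/

set_option autoImplicit false
-- the Theorems namespace of this sub repeats the summit name by design (D-0017 nested layout)
set_option linter.dupNamespace false

noncomputable section

open scoped Classical

open Polynomial CongruenceSubgroup Literature.NumberTheory.EllipticCurves Literature.NumberTheory.EllipticCurves.ModularForms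
  Summit.BirchSwinnertonDyer.BirchSwinnertonDyer.Theorems.ResidualThetaLayer

namespace Summit.BirchSwinnertonDyer.BirchSwinnertonDyer.Theorems.SmallImageRttReciprocity

/-! ## §1 Imprimitive reduction: the three-term relation evaluated at `ζ − 1` -/

section Imprimitive

variable {M : ℕ} [NeZero M] {g : CuspForm (Gamma0 M) 2} {p : ℕ} [Fact p.Prime] {Ω : ℂ} {R : Type*} [CommRing R]

/-- **The three-term relation at a point**: for a newform `g ∈ S₂(Γ₀(M))`, `p ∤ M`, `a_p(g) = 0`, a Shimura period `Ω`, a ring homomorphism `φ : K_g → R` and `ζ ∈ R` with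
`ζ^{p^{n+1}} = 1`: `θ_{n+2}(g;Ω)^φ(ζ − 1) = −Φ_{p^{n+1}}(ζ)·θ_n(g;Ω)^φ(ζ − 1)` — evaluate `ω_{n+1} ∣ θ_{n+2} + Φ_{p^{n+1}}(1+T)·θ_n` at `T = ζ − 1`, where `ω_{n+1}(ζ−1) = ζ^{p^{n+1}} − 1 = 0`.
[cite: MazurTateTeitelbaum1986Invent, §I.10 Prop. (10.2)] [cite: PollackWeston2011MT, §2.1–2.2] -/
theorem eval₂_mazurTateElementK_add_two (hg : IsNewform0 g) (hΩ : IsPlusPeriod g Ω) (hpM : ¬ p ∣ M) (hap : cuspCoeff g p = 0)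
    (φ : coeffField g →+* R) (n : ℕ) {ζ : R} (hζ : ζ ^ p ^ (n + 1) = 1) :
    (mazurTateElementK g Ω p (n + 2)).eval₂ φ (ζ - 1) = -((cyclotomic (p ^ (n + 1)) R).eval ζ) * (mazurTateElementK g Ω p n).eval₂ φ (ζ - 1) := by
  obtain ⟨C, hC⟩ := cyclotomicOmega_dvd_mazurTateElementK_add hg hΩ hpM hap n
  have h := congr_arg (Polynomial.eval₂ φ (ζ - 1)) hC
  have hω : ((cyclotomicOmega p (n + 1)).map (Int.castRingHom (coeffField g))).eval₂ φ (ζ - 1) = 0 := by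
    rw [eval₂_map, cyclotomicOmega, eval₂_sub, eval₂_pow, eval₂_add, eval₂_X, eval₂_one, sub_add_cancel, hζ, sub_self]
  have hΦ : (((cyclotomic (p ^ (n + 1)) ℤ).comp (X + 1)).map (Int.castRingHom (coeffField g))).eval₂ φ (ζ - 1) = (cyclotomic (p ^ (n + 1)) R).eval ζ := by
    rw [eval₂_map, eval₂_comp, eval₂_add, eval₂_X, eval₂_one, sub_add_cancel, ← map_cyclotomic_int (p ^ (n + 1)) R, eval_map]
    exact congrArg (fun f : ℤ →+* R ↦ (cyclotomic (p ^ (n + 1)) ℤ).eval₂ f ζ) (RingHom.ext_int _ _)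
  rw [eval₂_add, eval₂_mul, hΦ, eval₂_mul, hω, zero_mul] at h
  linear_combination h

/-- `Φ_{p^{n+1}}(ζ) = p` when `ζ^{p^n} = 1` (`Φ_{p^{n+1}}(X) = Σ_{i<p} X^{i p^n}`). [folklore] -/
theorem eval_cyclotomic_prime_pow_succ_of_pow_eq_one (n : ℕ) {ζ : R} (hζ : ζ ^ p ^ n = 1) :
    (cyclotomic (p ^ (n + 1)) R).eval ζ = p := by
  rw [cyclotomic_prime_pow_eq_geom_sum (Fact.out : p.Prime), eval_finsetSum]
  simp only [eval_pow, eval_X, hζ, one_pow, Finset.sum_const, Finset.card_range, Nat.smul_one_eq_cast]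

/-- ★ **Imprimitive reduction, non-vanishing parity**: if `ζ^{p^m} = 1` then `θ_{m+2k}(g;Ω)^φ(ζ − 1) = (−p)^k·θ_m(g;Ω)^φ(ζ − 1)` for every `k` — the character `χ_ζ` of conductor
dividing `p^{m+e₀}` sees, at the levels `m + 2k`, the level-`m` value times `(−p)^k` (`a_p(g) = 0`). [cite: MazurTateTeitelbaum1986Invent, §I.10 Prop. (10.2)]
[cite: Pollack2003, Prop. 6.18 (proof)] -/
theorem eval₂_mazurTateElementK_add_two_mul (hg : IsNewform0 g) (hΩ : IsPlusPeriod g Ω) (hpM : ¬ p ∣ M) (hap : cuspCoeff g p = 0)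
    (φ : coeffField g →+* R) (m : ℕ) {ζ : R} (hζ : ζ ^ p ^ m = 1) (k : ℕ) :
    (mazurTateElementK g Ω p (m + 2 * k)).eval₂ φ (ζ - 1) = (-(p : R)) ^ k * (mazurTateElementK g Ω p m).eval₂ φ (ζ - 1) := by
  induction k with
  | zero => simp
  | succ k ih =>
    have hζ' : ζ ^ p ^ (m + 2 * k) = 1 := by rw [pow_add, pow_mul, hζ, one_pow]
    have hζ'' : ζ ^ p ^ (m + 2 * k + 1) = 1 := by rw [pow_succ, pow_mul, hζ', one_pow]
    rw [show m + 2 * (k + 1) = m + 2 * k + 2 by ring, eval₂_mazurTateElementK_add_two hg hΩ hpM hap φ (m + 2 * k) hζ'',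
      eval_cyclotomic_prime_pow_succ_of_pow_eq_one (m + 2 * k) hζ', ih, pow_succ]
    ring

/-- ★ **Imprimitive reduction, vanishing parity**: if `ζ^{p^{m+1}} = 1` and `Φ_{p^{m+1}}(ζ) = 0` (e.g. `ζ` of exact order `p^{m+1}` in a domain) then
`θ_{m+2+2k}(g;Ω)^φ(ζ − 1) = 0` for every `k`: a character of conductor exactly `p^{m+1+e₀}` kills the levels `n` with `n − (m+1)` odd (`a_p(g) = 0`; the
`ω_n^∓`-divisibility of `θ_n`). [cite: Pollack2003, Prop. 6.18 (proof)] [cite: MazurTateTeitelbaum1986Invent, §I.10 Prop. (10.2)] -/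
theorem eval₂_mazurTateElementK_eq_zero_of_eval_cyclotomic_eq_zero (hg : IsNewform0 g) (hΩ : IsPlusPeriod g Ω) (hpM : ¬ p ∣ M) (hap : cuspCoeff g p = 0)
    (φ : coeffField g →+* R) (m : ℕ) {ζ : R} (hζ : ζ ^ p ^ (m + 1) = 1) (hΦ : (cyclotomic (p ^ (m + 1)) R).eval ζ = 0) (k : ℕ) :
    (mazurTateElementK g Ω p (m + 2 + 2 * k)).eval₂ φ (ζ - 1) = 0 := by
  have hζ' : ζ ^ p ^ (m + 2) = 1 := by rw [pow_succ, pow_mul, hζ, one_pow]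
  rw [eval₂_mazurTateElementK_add_two_mul hg hΩ hpM hap φ (m + 2) hζ' k, eval₂_mazurTateElementK_add_two hg hΩ hpM hap φ m hζ, hΦ]
  simp

/-- The same for `ζ` a PRIMITIVE `p^{m+1}`-th root of unity in a domain `R` (`Φ_{p^{m+1}}(ζ) = 0`, Mathlib `IsPrimitiveRoot.isRoot_cyclotomic`).
[cite: Pollack2003, Prop. 6.18 (proof)] -/
theorem eval₂_mazurTateElementK_eq_zero_of_isPrimitiveRoot [IsDomain R] (hg : IsNewform0 g) (hΩ : IsPlusPeriod g Ω) (hpM : ¬ p ∣ M) (hap : cuspCoeff g p = 0)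
    (φ : coeffField g →+* R) (m : ℕ) {ζ : R} (hζ : IsPrimitiveRoot ζ (p ^ (m + 1))) (k : ℕ) :
    (mazurTateElementK g Ω p (m + 2 + 2 * k)).eval₂ φ (ζ - 1) = 0 :=
  eval₂_mazurTateElementK_eq_zero_of_eval_cyclotomic_eq_zero hg hΩ hpM hap φ m hζ.pow_eq_one
    (hζ.isRoot_cyclotomic (pow_pos (Fact.out : p.Prime).pos _)) k

end Imprimitive

/-! ## §2 Character values over any commutative ring -/

section Character

variable {M : ℕ} (g : CuspForm (Gamma0 M) 2) {p : ℕ} [Fact p.Prime] (Ω : ℂ) {R : Type*} [CommRing R] (φ : coeffField g →+* R)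

omit [Fact p.Prime] in
/-- **Even `p`-power-order characters kill the Teichmüller representatives** (any coefficient ring `R`; the tree's `apply_toZModPow_rootsOfUnity` is `R = ℂ_p`):
`χ(η mod p^m) = 1` for `η ∈ μ_τ(ℤ_p)` — for odd `p` the order of `χ(η)` divides `gcd(p−1, p^j) = 1`; for `p = 2`, `η = ±1`. [cite: MazurTateTeitelbaum1986Invent, §I.13] -/
theorem apply_toZModPow_rootsOfUnity_eq_one [hp : Fact p.Prime] {m : ℕ} (χ : DirichletCharacter R (p ^ m)) (heven : χ.Even) (hord : ∃ j : ℕ, orderOf χ = p ^ j)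
    (η : rootsOfUnity (torsionOrder p) ℤ_[p]) :
    χ (PadicInt.toZModPow m ((η : ℤ_[p]ˣ) : ℤ_[p])) = 1 := by
  obtain ⟨j, hj⟩ := hord
  have hητ := rootsOfUnity_pow_torsionOrder p η
  by_cases h2 : p = 2
  · have hτ : torsionOrder p = 2 := by rw [torsionOrder_eq, if_pos h2]
    have hsq : ((η : ℤ_[p]ˣ) : ℤ_[p]) * ((η : ℤ_[p]ˣ) : ℤ_[p]) = 1 := by rw [← sq, ← hτ]; exact hητ
    rcases mul_self_eq_one_iff.mp hsq with h | h
    · rw [h, map_one, map_one]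
    · rw [h, map_neg, map_one]; exact heven
  · have hτ : torsionOrder p = p - 1 := by rw [torsionOrder_eq, if_neg h2]
    obtain ⟨v, hv⟩ : IsUnit (PadicInt.toZModPow m ((η : ℤ_[p]ˣ) : ℤ_[p])) := (Units.isUnit _).map _
    have h1 : χ (v : ZMod (p ^ m)) ^ (p - 1) = 1 := by
      rw [← map_pow, hv, ← map_pow, ← hτ, hητ, map_one, map_one]
    have h2' : χ (v : ZMod (p ^ m)) ^ (p ^ j) = 1 := by
      rw [← MulChar.pow_apply_coe, ← hj, pow_orderOf_eq_one, MulChar.one_apply_coe]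
    have hcop : Nat.Coprime (p - 1) (p ^ j) :=
      Nat.Coprime.pow_right j ((Nat.coprime_self_sub_left hp.out.one_le).mpr (Nat.coprime_one_left p))
    have h := pow_gcd_eq_one.mpr ⟨h1, h2'⟩
    rw [hcop.gcd_eq_one, pow_one] at h
    rw [← hv, h]

/-- ★ **The value of `θ_n(g; Ω)^φ` at a character of `Γ`**, over ANY commutative ring `R`: for an even `R`-valued Dirichlet character `χ` modulo `p^{n+e₀}` of `p`-power order,
`θ_n(g;Ω)^φ(χ(γ) − 1) = Σ_{a mod p^{n+e₀}} χ(a)·φ[a/p^{n+e₀}]⁺_{g,Ω}` (`(1+T)^s ↦ χ(γ)^s = χ(ηγ^s)` as `χ(η) = 1`; `(η, s) ↦ ηγ^s` is a bijection onto the units; non-units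
contribute `0`). The tree's `ResidualThetaLayer.eval₂_map_mazurTateElementK_eq_sum` is the case `R = ℂ_p`, `φ = (ℚ̄_p → ℂ_p) ∘ ι`.
[cite: Pollack2003, Prop. 6.9 (proof)] [cite: MazurTateTeitelbaum1986Invent, §I.13] -/
theorem eval₂_mazurTateElementK_eq_sum {n : ℕ} (χ : DirichletCharacter R (p ^ (n + cyclotomicExponent p))) (heven : χ.Even)
    (hord : ∃ j : ℕ, orderOf χ = p ^ j) :
    (mazurTateElementK g Ω p n).eval₂ φ (χ (cyclotomicGenerator p : ZMod (p ^ (n + cyclotomicExponent p))) - 1) =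
      ∑ a : ZMod (p ^ (n + cyclotomicExponent p)), χ a * φ (plusSymbolK g Ω ((a.val : ℚ) / (p : ℚ) ^ (n + cyclotomicExponent p))) := by
  classical
  have hp : p.Prime := Fact.out
  haveI := neZero_torsionOrder p
  haveI := Fintype.ofFinite (rootsOfUnity (torsionOrder p) ℤ_[p])
  haveI : NeZero (p ^ n) := ⟨pow_ne_zero _ hp.ne_zero⟩
  haveI : NeZero (p ^ (n + cyclotomicExponent p)) := ⟨pow_ne_zero _ hp.ne_zero⟩
  set G : ZMod (p ^ (n + cyclotomicExponent p)) → R := fun b ↦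
    χ b * φ (plusSymbolK g Ω ((b.val : ℚ) / (p : ℚ) ^ (n + cyclotomicExponent p))) with hG
  have h1 : (mazurTateElementK g Ω p n).eval₂ φ (χ (cyclotomicGenerator p : ZMod (p ^ (n + cyclotomicExponent p))) - 1) =
      ∑ᶠ η : rootsOfUnity (torsionOrder p) ℤ_[p], ∑ s : ZMod (p ^ n),
        G (PadicInt.toZModPow (n + cyclotomicExponent p) ((η : ℤ_[p]ˣ) : ℤ_[p]) *
          (cyclotomicGenerator p : ZMod (p ^ (n + cyclotomicExponent p))) ^ s.val) := by
    rw [mazurTateElementK, finsum_eq_sum_of_fintype, finsum_eq_sum_of_fintype, eval₂_finsetSum]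
    refine Finset.sum_congr rfl fun η _ ↦ ?_
    rw [eval₂_finsetSum]
    refine Finset.sum_congr rfl fun s _ ↦ ?_
    rw [eval₂_mul, eval₂_C, eval₂_pow, eval₂_add, eval₂_X, eval₂_one, sub_add_cancel, hG]
    dsimp only
    rw [map_mul, map_pow, apply_toZModPow_rootsOfUnity_eq_one χ heven hord η, one_mul, mul_comm]
  rw [h1, finsum_sum_classes_eq_sum_units p n G, sum_units_eq_sum_filter_isUnit, Finset.sum_filter]
  refine Finset.sum_congr rfl fun a _ ↦ ?_
  split_ifs with ha
  · rfl
  · rw [hG]; dsimp only; rw [MulChar.map_nonunit χ ha, zero_mul]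

/-- **The trivial character**: `θ_n(g;Ω)^φ(0) = Σ_{a ∈ (ℤ/p^{n+e₀})ˣ} φ[a/p^{n+e₀}]⁺_{g,Ω}` (non-units contribute `0`). [cite: Pollack2003, Prop. 6.9 (proof)]
[cite: MazurTateTeitelbaum1986Invent, §I.13] -/
theorem eval₂_mazurTateElementK_zero (n : ℕ) :
    (mazurTateElementK g Ω p n).eval₂ φ 0 =
      ∑ a : ZMod (p ^ (n + cyclotomicExponent p)), if IsUnit a then φ (plusSymbolK g Ω ((a.val : ℚ) / (p : ℚ) ^ (n + cyclotomicExponent p))) else 0 := by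
  classical
  have hp : p.Prime := Fact.out
  haveI : NeZero (p ^ (n + cyclotomicExponent p)) := ⟨pow_ne_zero _ hp.ne_zero⟩
  set χ : DirichletCharacter R (p ^ (n + cyclotomicExponent p)) := 1 with hχ
  have hγ : χ (cyclotomicGenerator p : ZMod (p ^ (n + cyclotomicExponent p))) = 1 := MulChar.one_apply (isUnit_cyclotomicGenerator_cast p _)
  have heven : χ.Even := MulChar.one_apply isUnit_one.neg
  have hord : ∃ j : ℕ, orderOf χ = p ^ j := ⟨0, by rw [pow_zero, hχ, orderOf_one]⟩
  have h := eval₂_mazurTateElementK_eq_sum g Ω φ χ heven hord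
  rw [hγ, sub_self] at h
  rw [h]
  refine Finset.sum_congr rfl fun a _ ↦ ?_
  by_cases ha : IsUnit a
  · rw [if_pos ha, hχ, MulChar.one_apply ha, one_mul]
  · rw [if_neg ha, hχ, MulChar.map_nonunit _ ha, zero_mul]

end Character

/-! ## §3 The bottom of the tower (`p` odd): the unit sums at levels `p` and `p²`, and `θ_n(g;Ω)(0)` -/

section Bottom

variable {M : ℕ} [NeZero M] {g : CuspForm (Gamma0 M) 2} {p : ℕ} [Fact p.Prime] {Ω : ℂ}

omit [NeZero M] [Fact p.Prime] in
/-- Reindexing a sum over `ℤ/m` by the representatives `0 ≤ a.val < m`. [folklore] -/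
theorem sum_univ_zmod_val_eq_sum_range {A : Type*} [AddCommMonoid A] (m : ℕ) [NeZero m] (F : ℕ → A) :
    ∑ a : ZMod m, F a.val = ∑ k ∈ Finset.range m, F k := by
  refine Finset.sum_bij (fun a _ ↦ a.val) (fun a _ ↦ Finset.mem_range.mpr (ZMod.val_lt a))
    (fun a _ b _ h ↦ ZMod.val_injective m h) (fun k hk ↦ ?_) (fun _ _ ↦ rfl)
  exact ⟨(k : ZMod m), Finset.mem_univ _, ZMod.val_cast_of_lt (Finset.mem_range.mp hk)⟩

/-- **Level `p`**: `Σ_{a ∈ (ℤ/p)ˣ} [a/p]⁺_{g,Ω} = −2·[0]⁺_{g,Ω}` for `a_p(g) = 0` (remove the term `a = 0`, `[0/p]⁺ = [0]⁺`, from the Hecke-nullity `Σ_{j<p} [j/p]⁺ = −[0]⁺`,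
`ResidualThetaLayer.sum_range_plusSymbolK_div_eq_neg`). Stated for a modulus `m = p` (to be instantiated at `m = p^{0+e₀}`). [cite: MazurTateTeitelbaum1986Invent, §I.4 (4.2)]
[cite: Pollack2003, §6 (the value `L_p^-(E,0) = 2L(E,1)/Ω_E`)] -/
theorem sum_isUnit_plusSymbolK_eq_of_eq (hg : IsNewform0 g) (hΩ : IsPlusPeriod g Ω) (hpM : ¬ p ∣ M) (hap : cuspCoeff g p = 0) {m : ℕ} [NeZero m] (hm : m = p) :
    (∑ a : ZMod m, if IsUnit a then plusSymbolK g Ω ((a.val : ℚ) / (m : ℚ)) else 0) = -2 * plusSymbolK g Ω 0 := by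
  classical
  have hp : p.Prime := Fact.out
  obtain rfl : p = m := hm.symm
  have hunit : ∀ a : ZMod p, IsUnit a ↔ ¬ p ∣ a.val := fun a ↦ by
    conv_lhs => rw [← ZMod.natCast_zmod_val a]
    have h := ZMod.isUnit_natCast_iff_not_dvd_pow (a := a.val) hp Nat.one_pos
    rwa [pow_one] at h
  have hsum : (∑ a : ZMod p, if IsUnit a then plusSymbolK g Ω ((a.val : ℚ) / (p : ℚ)) else 0) =
      ∑ k ∈ Finset.range p, (if ¬ p ∣ k then plusSymbolK g Ω ((k : ℚ) / (p : ℚ)) else 0) := by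
    rw [← sum_univ_zmod_val_eq_sum_range p (fun k ↦ if ¬ p ∣ k then plusSymbolK g Ω ((k : ℚ) / (p : ℚ)) else 0)]
    refine Finset.sum_congr rfl fun a _ ↦ ?_
    simp only [hunit a]
  rw [hsum]
  have hkey : ∀ k ∈ Finset.range p, (if ¬ p ∣ k then plusSymbolK g Ω ((k : ℚ) / (p : ℚ)) else 0) =
      plusSymbolK g Ω ((k : ℚ) / (p : ℚ)) - if k = 0 then plusSymbolK g Ω ((k : ℚ) / (p : ℚ)) else 0 := by
    intro k hk
    rw [Finset.mem_range] at hk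
    by_cases h0 : k = 0
    · subst h0; simp
    · have hnd : ¬ p ∣ k := fun hd ↦ h0 (Nat.eq_zero_of_dvd_of_lt hd hk)
      rw [if_pos hnd, if_neg h0, sub_zero]
  have h3 := sum_range_plusSymbolK_div_eq_neg hg hΩ hpM hap (0 : ℚ)
  simp only [zero_add, mul_zero] at h3
  rw [Finset.sum_congr rfl hkey, Finset.sum_sub_distrib, Finset.sum_ite_eq' (Finset.range p), if_pos (Finset.mem_range.mpr hp.pos), h3,
    Nat.cast_zero, zero_div]
  ring

/-- **Level `p²`**: `Σ_{a ∈ (ℤ/p²)ˣ} [a/p²]⁺_{g,Ω} = −(p − 1)·[0]⁺_{g,Ω}` for `a_p(g) = 0`: writing `a = b + p c` (`0 ≤ b, c < p`), `a` is a unit iff `b ≠ 0`, and for `b ≠ 0`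
`Σ_{c<p} [(b + pc)/p²]⁺ = Σ_{c<p} [(b/p + c)/p]⁺ = −[b]⁺ = −[0]⁺` (Hecke-nullity at `r = b/p`, `ℤ`-periodicity `ResidualThetaLayer.plusSymbolK_add_intCast`). Stated for a modulus
`m = p·p`. [cite: MazurTateTeitelbaum1986Invent, §I.4 (4.2)] [cite: Pollack2003, §6 (the value `L_p^+(E,0) = (p−1)L(E,1)/Ω_E`)] -/
theorem sum_isUnit_plusSymbolK_eq_of_eq_sq (hg : IsNewform0 g) (hΩ : IsPlusPeriod g Ω) (hpM : ¬ p ∣ M) (hap : cuspCoeff g p = 0) {m : ℕ} [NeZero m]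
    (hm : m = p * p) :
    (∑ a : ZMod m, if IsUnit a then plusSymbolK g Ω ((a.val : ℚ) / (m : ℚ)) else 0) = -((p : coeffField g) - 1) * plusSymbolK g Ω 0 := by
  classical
  have hp : p.Prime := Fact.out
  have hp0 : (p : ℚ) ≠ 0 := Nat.cast_ne_zero.mpr hp.ne_zero
  obtain rfl : p * p = m := hm.symm
  have hunit : ∀ a : ZMod (p * p), IsUnit a ↔ ¬ p ∣ a.val := fun a ↦ by
    conv_lhs => rw [← ZMod.natCast_zmod_val a]
    have h := ZMod.isUnit_natCast_iff_not_dvd_pow (a := a.val) hp Nat.two_pos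
    rwa [pow_two] at h
  set G : ℕ → coeffField g := fun k ↦ if ¬ p ∣ k then plusSymbolK g Ω ((k : ℚ) / ((p * p : ℕ) : ℚ)) else 0 with hG
  have hsum : (∑ a : ZMod (p * p), if IsUnit a then plusSymbolK g Ω ((a.val : ℚ) / ((p * p : ℕ) : ℚ)) else 0) = ∑ k ∈ Finset.range (p * p), G k := by
    rw [← sum_univ_zmod_val_eq_sum_range (p * p) G]
    refine Finset.sum_congr rfl fun a _ ↦ ?_
    simp only [hG, hunit a]
  rw [hsum, ← Fin.sum_univ_eq_sum_range G (p * p), ← finProdFinEquiv.sum_comp (fun x : Fin (p * p) ↦ G x), Fintype.sum_prod_type_right]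
  simp only [finProdFinEquiv_apply_val]
  have hinner : ∀ b : Fin p, ∑ c : Fin p, G ((b : ℕ) + p * (c : ℕ)) = if (b : ℕ) = 0 then 0 else -plusSymbolK g Ω 0 := by
    intro b
    have hbp : (b : ℕ) < p := b.2
    have hdvd : ∀ c : ℕ, p ∣ (b : ℕ) + p * c ↔ (b : ℕ) = 0 := fun c ↦ by
      constructor
      · intro h
        have hb : p ∣ (b : ℕ) := (Nat.dvd_add_left (Dvd.intro _ rfl)).mp h
        exact Nat.eq_zero_of_dvd_of_lt hb hbp
      · intro h; rw [h, zero_add]; exact Dvd.intro _ rfl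
    by_cases hb0 : (b : ℕ) = 0
    · rw [if_pos hb0]
      refine Finset.sum_eq_zero fun c _ ↦ ?_
      rw [hG]; dsimp only; rw [if_neg (not_not.mpr ((hdvd c).mpr hb0))]
    · rw [if_neg hb0]
      have hterm : ∀ c : Fin p, G ((b : ℕ) + p * (c : ℕ)) = plusSymbolK g Ω (((((b : ℕ) : ℚ) / p) + (c : ℕ)) / p) := by
        intro c
        have hq : ((((b : ℕ) + p * (c : ℕ) : ℕ) : ℚ)) / ((p * p : ℕ) : ℚ) = ((((b : ℕ) : ℚ) / p) + (c : ℕ)) / p := by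
          push_cast
          field_simp
        rw [hG]; dsimp only; rw [if_pos (fun h ↦ hb0 ((hdvd c).mp h)), hq]
      rw [Finset.sum_congr rfl fun c _ ↦ hterm c, Fin.sum_univ_eq_sum_range (fun c ↦ plusSymbolK g Ω (((((b : ℕ) : ℚ) / p) + c) / p)) p,
        sum_range_plusSymbolK_div_eq_neg hg hΩ hpM hap, mul_div_cancel₀ _ hp0]
      have := plusSymbolK_add_intCast hΩ 0 ((b : ℕ) : ℤ)
      rw [zero_add, Int.cast_natCast] at this
      rw [this]
  rw [Finset.sum_congr rfl fun b _ ↦ hinner b, Fin.sum_univ_eq_sum_range (fun b ↦ if b = 0 then (0 : coeffField g) else -plusSymbolK g Ω 0) p]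
  have hcount : ∑ b ∈ Finset.range p, (if b = 0 then (0 : coeffField g) else -plusSymbolK g Ω 0) =
      ∑ b ∈ Finset.range p, (-plusSymbolK g Ω 0) - ∑ b ∈ Finset.range p, (if b = 0 then -plusSymbolK g Ω 0 else 0) := by
    rw [← Finset.sum_sub_distrib]
    refine Finset.sum_congr rfl fun b _ ↦ ?_
    by_cases hb : b = 0
    · rw [if_pos hb, if_pos hb, sub_self]
    · rw [if_neg hb, if_neg hb, sub_zero]
  rw [hcount, Finset.sum_const, Finset.card_range, Finset.sum_ite_eq' (Finset.range p), if_pos (Finset.mem_range.mpr hp.pos), nsmul_eq_mul]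
  ring

variable {R : Type*} [CommRing R] (φ : coeffField g →+* R)

/-- ★ **Trivial character, even levels** (`p` odd): `θ_{2k}(g;Ω)^φ(0) = (−p)^k·φ(−2·[0]⁺_{g,Ω})`. [cite: Pollack2003, §6.5 (Prop. 6.18 at n = 0)]
[cite: MazurTateTeitelbaum1986Invent, §I.10 Prop. (10.2)] -/
theorem eval₂_mazurTateElementK_two_mul_zero (hp2 : p ≠ 2) (hg : IsNewform0 g) (hΩ : IsPlusPeriod g Ω) (hpM : ¬ p ∣ M) (hap : cuspCoeff g p = 0) (k : ℕ) :
    (mazurTateElementK g Ω p (2 * k)).eval₂ φ 0 = (-(p : R)) ^ k * φ (-2 * plusSymbolK g Ω 0) := by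
  classical
  have hp : p.Prime := Fact.out
  have he : cyclotomicExponent p = 1 := by rw [cyclotomicExponent, if_neg hp2]
  haveI : NeZero (p ^ (0 + cyclotomicExponent p)) := ⟨pow_ne_zero _ hp.ne_zero⟩
  have h0 : (mazurTateElementK g Ω p 0).eval₂ φ 0 = φ (-2 * plusSymbolK g Ω 0) := by
    rw [eval₂_mazurTateElementK_zero g Ω φ 0]
    have hq : p ^ (0 + cyclotomicExponent p) = p := by rw [he, zero_add, pow_one]
    rw [← sum_isUnit_plusSymbolK_eq_of_eq hg hΩ hpM hap hq, map_sum]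
    refine Finset.sum_congr rfl fun a _ ↦ ?_
    split_ifs <;> simp
  have h := eval₂_mazurTateElementK_add_two_mul hg hΩ hpM hap φ 0 (ζ := 1) (by simp) k
  rw [zero_add, sub_self] at h
  rw [h, h0]

/-- ★ **Trivial character, odd levels** (`p` odd): `θ_{2k+1}(g;Ω)^φ(0) = (−p)^k·φ(−(p−1)·[0]⁺_{g,Ω})`. [cite: Pollack2003, §6.5 (Prop. 6.18 at n = 1)]
[cite: MazurTateTeitelbaum1986Invent, §I.10 Prop. (10.2)] -/
theorem eval₂_mazurTateElementK_two_mul_add_one_zero (hp2 : p ≠ 2) (hg : IsNewform0 g) (hΩ : IsPlusPeriod g Ω) (hpM : ¬ p ∣ M) (hap : cuspCoeff g p = 0) (k : ℕ) :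
    (mazurTateElementK g Ω p (2 * k + 1)).eval₂ φ 0 = (-(p : R)) ^ k * φ (-((p : coeffField g) - 1) * plusSymbolK g Ω 0) := by
  classical
  have hp : p.Prime := Fact.out
  have he : cyclotomicExponent p = 1 := by rw [cyclotomicExponent, if_neg hp2]
  haveI : NeZero (p ^ (1 + cyclotomicExponent p)) := ⟨pow_ne_zero _ hp.ne_zero⟩
  have h1 : (mazurTateElementK g Ω p 1).eval₂ φ 0 = φ (-((p : coeffField g) - 1) * plusSymbolK g Ω 0) := by
    rw [eval₂_mazurTateElementK_zero g Ω φ 1]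
    have hq : p ^ (1 + cyclotomicExponent p) = p * p := by rw [he]; ring
    rw [← sum_isUnit_plusSymbolK_eq_of_eq_sq hg hΩ hpM hap hq, map_sum]
    refine Finset.sum_congr rfl fun a _ ↦ ?_
    split_ifs <;> simp
  have h := eval₂_mazurTateElementK_add_two_mul hg hΩ hpM hap φ 1 (ζ := 1) (by simp) k
  rw [sub_self] at h
  rw [show 2 * k + 1 = 1 + 2 * k by ring, h, h1]

end Bottom

/-! ## §4 Primitive values in closed form (Birch's formula) under the symbol transport along `φ : K_g → ℂ` -/

section Closed

variable {M : ℕ} (g : CuspForm (Gamma0 M) 2) {p : ℕ} [Fact p.Prime] (Ω : ℂ) (φ : coeffField g →+* ℂ)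
  {M' : ℕ} [NeZero M'] (g' : CuspForm (Gamma0 M') 2) (Ω' : ℂ) (hsym : ∀ r : ℚ, plusSymbol g' r = Ω' * φ (plusSymbolK g Ω r))

include hsym in
/-- ★★★ **Primitive character values in closed form.** Let `g ∈ S₂(Γ₀(M))`, `Ω ∈ ℂ`, `φ : K_g → ℂ`, and let `(g', Ω')` TRANSPORT the `K_g`-valued symbols of `(g, Ω)` along `φ`:
`plusSymbol g' r = Ω'·φ([r]⁺_{g,Ω})` for all `r ∈ ℚ` (`g' = g`, `φ = incl`, `Ω' = Ω` when `Ω` is a Shimura period; `g' = g^σ`, `φ = σ` by Shimura's σ-equivariance of the periods of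
conjugate newforms). Then for every PRIMITIVE even `p`-power-order Dirichlet character `χ` modulo `p^{n+e₀}` and every entire continuation `L` of the twisted `L`-series `L(g', χ̄, s)`:
`Ω'·θ_n(g;Ω)^φ(χ(γ) − 1) = τ(χ)·L(g', χ̄, 1)` — §2 and Birch's formula `τ(χ̄⁻¹)·L(g',χ̄,1) = Σ_a χ(a){∞, a/p^{n+e₀}}_{g'}` (tree theorem `twisted_LValue_eq_holds`) with
`Σ_a χ(a){∞,a/m} = Σ_a χ(a)·plusSymbol(a/m)` for even `χ`. [cite: MazurTateTeitelbaum1986Invent, §I.8 (8.6)] [cite: PollackWeston2011MT, §2.2 Prop. 2.3] [cite: Birch1971] -/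
theorem mul_eval₂_mazurTateElementK_eq_gaussSum_mul {n : ℕ} (χ : DirichletCharacter ℂ (p ^ (n + cyclotomicExponent p))) (heven : χ.Even)
    (hord : ∃ j : ℕ, orderOf χ = p ^ j) (hprim : χ.IsPrimitive) {L : ℂ → ℂ} (hL : Differentiable ℂ L)
    (hL' : ∀ s : ℂ, 2 < s.re → L s = twistedLSeries g' χ⁻¹ s) :
    Ω' * (mazurTateElementK g Ω p n).eval₂ φ (χ (cyclotomicGenerator p : ZMod (p ^ (n + cyclotomicExponent p))) - 1) =
      gaussSum χ (ZMod.stdAddChar (N := p ^ (n + cyclotomicExponent p))) * L 1 := by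
  classical
  have hp : p.Prime := Fact.out
  haveI : NeZero (p ^ (n + cyclotomicExponent p)) := ⟨pow_ne_zero _ hp.ne_zero⟩
  rw [eval₂_mazurTateElementK_eq_sum g Ω φ χ heven hord, Finset.mul_sum]
  have h1 : ∑ a : ZMod (p ^ (n + cyclotomicExponent p)), Ω' * (χ a * φ (plusSymbolK g Ω ((a.val : ℚ) / (p : ℚ) ^ (n + cyclotomicExponent p)))) =
      ∑ a : ZMod (p ^ (n + cyclotomicExponent p)), χ a * plusSymbol g' ((a.val : ℚ) / ((p ^ (n + cyclotomicExponent p) : ℕ) : ℚ)) := by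
    refine Finset.sum_congr rfl fun a _ ↦ ?_
    rw [hsym, Nat.cast_pow]
    ring
  have hprim' : χ⁻¹.IsPrimitive := by
    rw [DirichletCharacter.isPrimitive_def, DirichletCharacter.conductor_inv]
    exact hprim
  have hB := twisted_LValue_eq_holds g' (m := p ^ (n + cyclotomicExponent p)) hprim' hL hL'
  rw [inv_inv] at hB
  rw [h1, ← twistedSymbolSum_eq_sum_plusSymbol heven, ← hB]

include hsym in
/-- **The bottom value**: `Ω'·φ[0]⁺_{g,Ω} = {∞, 0}_{g'} = L(g', 1)` for every entire continuation `L` of `L(g', s)` (`modularSymbol_zero_eq_holds`; `plusSymbol g' 0 = {∞,0}_{g'}`).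
[cite: MazurTateTeitelbaum1986Invent, §I.8] [cite: Manin1972, Thm. 1.3 proof] -/
theorem mul_map_plusSymbolK_zero_eq {L : ℂ → ℂ} (hL : Differentiable ℂ L) (hL' : ∀ s : ℂ, 2 < s.re → L s = cuspFormLSeries g' s) :
    Ω' * φ (plusSymbolK g Ω 0) = L 1 := by
  have h := hsym 0
  rw [plusSymbol, neg_zero, ← two_mul, mul_div_cancel_left₀ _ (two_ne_zero' ℂ), modularSymbol_zero_eq_holds g' hL hL'] at h
  exact h.symm

end Closed

end Summit.BirchSwinnertonDyer.BirchSwinnertonDyer.Theorems.SmallImageRttReciprocity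

end
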